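import Literature.NumberTheory.GelbartRogawski1991.LocalScaleModelTransport
import Literature.RepresentationTheory.HeisenbergGroup.SchrodingerAddCharRescaling
import Literature.RepresentationTheory.HeisenbergGroup.SchrodingerAddCharDilation
import HarnessLib

/-!
# `ψ_v(κ·)` versus the line `⟨t·a⟩`: the local Schrödinger package at a rescaled character is the package of a rescaled Gram matrix

Topic `NumberTheory/GelbartRogawski1991`; namespace `Literature.NumberTheory.GelbartRogawski1991.UnitaryDualPair.LocalSplitting`.
KERNEL mathematics only (theorems; no definition, no named fact, no `sorry`).  Cell hodgecm-mathlib, row III-11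
(eps-rigidity under Galois twist), road piece **P4** «`ψ_v(κ·) ↔ ⟨κ⟩`-scaling + square classes»: the LOCAL
assembly, at the tree's objects `localSchrodinger F N T v` / `LocalMp F N T v` / `iota`, of the two generic steps

* centre rescaling `(w, t₀) ↦ (w, a t₀) : H(B) ≃* H(B′)` for `B′ = a·B` pointwise (`Heisenberg.centerRescale`, with
  `mem_symplecticGroup_smul_iff`, file `SchrodingerAddCharRescaling`) — used here DIRECTLY between `β_T` and `β_{tT}` so that
  the target is the tree's `localSchrodinger F N (tT) v` on the nose (no transport along an equation of pairings), and
* square classes `S̃p_{ψ(s²·)}(W_β) ≃ S̃p_ψ(W_β)` intertwined by the dilation `D_s` (`exists_mpPsi_equiv_mulShift_sq`,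
  file `SchrodingerAddCharDilation`),

with B-p13's «`β_{tT} = t•β_T` on the nose» (`localPairing_of_eq_smul_eq`, file `LocalScaleModelTransport`).

**Statement** (`exists_mpPsi_equiv_localMp_of_mulShift`).  Let `ψ_v = adeleAddCharAt F v`, `T ∈ M_N(F)`, `t ∈ Fˣ`,
`T′ = t•T`, and let `ψ′` be ANY additive character of `F_v` of the form `ψ′(r) = ψ_v(κ r)` with `κ = t·s²`, `s ∈ F_vˣ`
(i.e. `κ/t` a square; the unit `κ` itself never needs a name).  Then MVW's group of pairs of the `ψ′`-Schrödinger model of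
`β_T` is isomorphic to the tree's `LocalMp F N T′ v` (the `ψ_v`-model of `β_{T′}`) by an isomorphism `e` which
(i) does not move the underlying automorphism of `𝕎_v = F_vᴺ × F_vᴺ` (`proj (e p) = proj p` as linear maps) and
(ii) conjugates the Weil representations by the dilation `D_s : f ↦ f(s⁻¹·)`: `ω(e p)(D_s f) = D_s (ω(p) f)`.
With the unitary group: `ι^{T′}_δ ∘ scaleInl = ι^T_δ` as automorphisms of `𝕎_v` (`coe_iota_scaleInl` — the retyping
`scaleInl : U(J)(F_v) → U(tJ)(F_v)` is the identity on matrices), so a section `σ` over `ι^T_δ` into the `ψ′`-model is carried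
to a section `σ′` over `ι^{T′}_δ` into `LocalMp F N T′ v` with `ω_{σ′}(scaleInl k) ∘ D_s = D_s ∘ ω_σ(k)`
(`exists_section_localMp_of_mulShift`) — in the language of the road memo: «the `ψ_v(κ·)`-package of the line `⟨a⟩` IS
the `ψ_v`-package of the line `⟨t a⟩`» (Gram `T_V ⊗ (a) ↦ T_V ⊗ (t a)`, `gram_prodUnique_TW`), with the SAME `δ`.

The square-class input `κ = t·s²` (a GLOBAL `t` with `κ/t ∈ (F_vˣ)²`, e.g. totally positive with prescribed square classes
at finitely many places) is supplied by weak approximation elsewhere (road piece P5); the identification of `ψ′ = σ ∘ ψ_v`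
with `ψ_v(κ·)`, `κ = χ_cyc(σ)`, is road piece P3a.  References: [MoeglinVignerasWaldspurger1987] Chap. 2 II.1, II Remarques
(2)–(3) (similitudes act on `H` and `S̃p_ψ`; dependence on `ψ` only through `F^×/(F^×)²`); [Kudla1994] §1;
[GelbartRogawski1991] §3.1 p. 454.
-/

set_option autoImplicit false

noncomputable section

open scoped Matrix
open NumberField IsDedekindDomain
open Literature.RepresentationTheory.HeisenbergGroup
open Literature.NumberTheory.Automorphic Literature.NumberTheory.Automorphic.UnitaryGroup

namespace Literature.NumberTheory.GelbartRogawski1991.UnitaryDualPair.LocalSplitting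

variable (F E : Type) [Field F] [NumberField F] [Field E] [NumberField E] [Algebra F E]
  [Algebra.IsQuadraticExtension F E] (c : E ≃ₐ[F] E) (N : ℕ)
  {δ : E} (hcδ : c δ = -δ) (hδ : δ ≠ 0) {d : F} (hd : δ * δ = algebraMap F E d)
  (T T' : Matrix (Fin N) (Fin N) F) (hT : T.IsSymm) (hT' : T'.IsSymm) (t : Fˣ) (hTT' : T' = (t : F) • T)
  {J J' : Matrix (Fin N) (Fin N) E} (hJ : J = T.map (algebraMap F E)) (hJ' : J' = T'.map (algebraMap F E))
  (v : HeightOneSpectrum (𝓞 F))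

/-! ## §1 Continuity of the local pairing (public restatement) -/

/-- `β_{𝕋_v}(·, y)` is continuous on `F_vᴺ` (a linear form on a finite free module over the topological field `F_v`).
[cite: Weil1964, n° 34, p. 182] -/
theorem continuous_localPairing_apply_left (y : Fin N → v.adicCompletion F) :
    Continuous fun u : Fin N → v.adicCompletion F => localPairing F N T v u y := by
  simp only [Matrix.toLinearMap₂'_apply', dotProduct]
  exact continuous_finsetSum _ fun i _ => (continuous_apply i).mul continuous_const

/-! ## §2 `β_{tT} = t•β_T`: the symplectic groups coincide and the centre rescaling `H(β_T) ≃ H(β_{tT})` -/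

section Chain

include hTT' in
/-- `polar β_{T′} = t · polar β_T` pointwise (`T′ = t•T`). [cite: Weil1964, n° 34, p. 182] -/
theorem polar_localPairing_of_eq_smul
    (p q : (Fin N → v.adicCompletion F) × (Fin N → v.adicCompletion F)) :
    polar (localPairing F N T' v) p q =
      ((unitAt F t v : (v.adicCompletion F)ˣ) : v.adicCompletion F) * polar (localPairing F N T v) p q := by
  rw [polar_apply, polar_apply, localPairing_of_eq_smul F N T T' t hTT' v, map_smul, smul_eq_mul]
  rfl

include hTT' in
/-- **`Sp(𝕎_v, β_T) = Sp(𝕎_v, β_{tT})`** as subgroups of `GL(𝕎_v)` (the alternating forms differ by the unit `t`).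
[cite: MoeglinVignerasWaldspurger1987, Chap. 2 II Remarque (2)] -/
theorem localSp_eq_of_eq_smul : LocalSp F N T v = LocalSp F N T' v := by
  ext g
  show g ∈ symplecticGroup (polar (localPairing F N T v)) ↔ g ∈ symplecticGroup (polar (localPairing F N T' v))
  rw [localPairing_of_eq_smul_eq F N T T' t hTT' v]
  exact (mem_symplecticGroup_smul_iff (localPairing F N T v) (unitAt F t v) g).symm

include hTT' in
/-- **the centre rescaling `(w, t₀) ↦ (w, t·t₀) : H(β_T) ≃* H(β_{tT})` intertwines the `ψ_v(t·)`-Schrödinger model of `β_T`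
with the tree's `ψ_v`-model `localSchrodinger F N (tT) v`** — same operators on `𝒮(F_vᴺ)`:
`ψ_v(t(t₀ + β_T(u,y))) f(u+x) = ψ_v(t t₀ + β_{tT}(u,y)) f(u+x)`. [cite: MoeglinVignerasWaldspurger1987, Chap. 2 I.4 Exemple (1) and II Remarque (2)] -/
theorem schrodingerSB_mulShift_eq_localSchrodinger_centerRescale
    (hlt : IsLocallyConstant (⇑((adeleAddCharAt F v).mulShift ((unitAt F t v : (v.adicCompletion F)ˣ) : v.adicCompletion F)) :
      v.adicCompletion F → Circle))
    (hb : ∀ y : Fin N → v.adicCompletion F, Continuous fun u : Fin N → v.adicCompletion F => localPairing F N T v u y)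
    (h : Heisenberg (polar (localPairing F N T v))) (f : SchwartzBruhat (Fin N → v.adicCompletion F)) :
    schrodingerSB (localPairing F N T v)
        ((adeleAddCharAt F v).mulShift ((unitAt F t v : (v.adicCompletion F)ˣ) : v.adicCompletion F)) hlt hb h f =
      localSchrodinger F N T' v
        (Heisenberg.centerRescale (polar (localPairing F N T v)) (polar (localPairing F N T' v)) (unitAt F t v)
          (polar_localPairing_of_eq_smul F N T T' t hTT' v) h) f := by
  apply Subtype.ext
  funext u
  change _ = ((schrodingerSB _ _ _ _ _ f : SchwartzBruhat _) : _ → ℂ) u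
  rw [schrodingerSB_apply, schrodingerSB_apply, AddChar.mulShift_apply, Heisenberg.centerRescale_t,
    Heisenberg.centerRescale_v, localPairing_of_eq_smul F N T T' t hTT' v, map_smul, smul_eq_mul, mul_add]
  rfl

include hTT' in
/-- Weil's sections correspond under the centre rescaling `H(β_T) ≃ H(β_{tT})` and the identity `Sp(β_T) = Sp(β_{tT})`.
[cite: Weil1964, n° 5 (5)–(6), pp. 149–151] -/
theorem centerRescale_ofSymplectic_act_localSp (g : LocalSp F N T v) (h : Heisenberg (polar (localPairing F N T v))) :
    Heisenberg.centerRescale (polar (localPairing F N T v)) (polar (localPairing F N T' v)) (unitAt F t v)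
        (polar_localPairing_of_eq_smul F N T T' t hTT' v) ((ofSymplectic (polar (localPairing F N T v)) g).act h) =
      (ofSymplectic (polar (localPairing F N T' v))
          (MulEquiv.subgroupCongr (localSp_eq_of_eq_smul F N T T' t hTT' v) g)).act
        (Heisenberg.centerRescale (polar (localPairing F N T v)) (polar (localPairing F N T' v)) (unitAt F t v)
          (polar_localPairing_of_eq_smul F N T T' t hTT' v) h) := by
  refine Heisenberg.ext ?_ ?_
  · rw [Heisenberg.centerRescale_v, Heisenberg.PseudoSymplectic.act_v, Heisenberg.PseudoSymplectic.act_v, ofSymplectic_σ,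
      ofSymplectic_σ, Heisenberg.centerRescale_v, MulEquiv.subgroupCongr_apply]
  · rw [Heisenberg.centerRescale_t, Heisenberg.PseudoSymplectic.act_t, Heisenberg.PseudoSymplectic.act_t, ofSymplectic_f,
      ofSymplectic_f, Heisenberg.centerRescale_t, Heisenberg.centerRescale_v, MulEquiv.subgroupCongr_apply,
      polar_localPairing_of_eq_smul F N T T' t hTT' v, polar_localPairing_of_eq_smul F N T T' t hTT' v]
    ring

/-! ## §3 The chain `S̃p_{ψ′}(𝕎_v, β_T) ≃ S̃p_{ψ_v(t·)}(𝕎_v, β_T) ≃ S̃p_{ψ_v}(𝕎_v, β_{tT}) = LocalMp F N T′ v` -/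

set_option maxHeartbeats 400000 in
include hTT' in
/-- **P4, local form.**  For `T′ = t•T` (`t ∈ Fˣ` global), `s ∈ F_vˣ` and any locally constant character `ψ′` of `F_v` with
`ψ′(r) = ψ_v(t s² r)` (`ψ_v = adeleAddCharAt F v`): there is a group isomorphism
`e : S̃p_{ψ′}(𝕎_v, β_T) ≃* LocalMp F N T′ v` which (i) lies over the identity on automorphisms of `𝕎_v` and
(ii) satisfies `ω(e p) (D_s f) = D_s (ω(p) f)` for the dilation `D_s = leviEquivSB (s•1)` of `𝒮(F_vᴺ)`.
It is (square-class dilation `ψ_v(t·)(s²·) ⇝ ψ_v(t·)`, `exists_mpPsi_equiv_mulShift_sq`) followed by (centre rescaling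
`ψ_v(t·), β_T ⇝ ψ_v, β_{tT}`, `MpPsi.congr` along `(centerRescale, 1, Sp(β_T) = Sp(β_{tT}))`).
[cite: MoeglinVignerasWaldspurger1987, Chap. 2 II.1 and II Remarques (2)–(3)] -/
theorem exists_mpPsi_equiv_localMp_of_mulShift
    (ψ' : AddChar (v.adicCompletion F) Circle) (hl' : IsLocallyConstant (⇑ψ' : v.adicCompletion F → Circle))
    (hb : ∀ y : Fin N → v.adicCompletion F, Continuous fun u : Fin N → v.adicCompletion F => localPairing F N T v u y)
    (s : (v.adicCompletion F)ˣ)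
    (hψ' : ∀ r, ψ' r = adeleAddCharAt F v
      (algebraMap F (v.adicCompletion F) (t : F) * ((s : v.adicCompletion F) * s) * r)) :
    ∃ e : MpPsi (schrodingerSB (localPairing F N T v) ψ' hl' hb) ≃* LocalMp F N T' v,
      (∀ p, ((MpPsi.proj _ (e p) : LocalSp F N T' v) :
          ((Fin N → v.adicCompletion F) × (Fin N → v.adicCompletion F)) ≃ₗ[v.adicCompletion F]
            ((Fin N → v.adicCompletion F) × (Fin N → v.adicCompletion F))) =
        (MpPsi.proj _ p : LocalSp F N T v)) ∧
      ∀ p (f : SchwartzBruhat (Fin N → v.adicCompletion F)),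
        MpPsi.toRep (localSchrodinger F N T' v) (e p)
            (leviEquivSB (LinearEquiv.smulOfUnit s) (continuous_const_smul (s : v.adicCompletion F))
              (continuous_const_smul ((s⁻¹ : (v.adicCompletion F)ˣ) : v.adicCompletion F)) f) =
          leviEquivSB (LinearEquiv.smulOfUnit s) (continuous_const_smul (s : v.adicCompletion F))
            (continuous_const_smul ((s⁻¹ : (v.adicCompletion F)ˣ) : v.adicCompletion F)) (MpPsi.toRep _ p f) := by
  -- the local character and its rescalings
  have hlv : IsLocallyConstant (⇑(adeleAddCharAt F v) : v.adicCompletion F → Circle) :=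
    isLocallyConstant_of_isContinuousNontrivial (isContinuousNontrivial_adeleAddCharAt F v)
  have hlt : IsLocallyConstant
      (⇑((adeleAddCharAt F v).mulShift ((unitAt F t v : (v.adicCompletion F)ˣ) : v.adicCompletion F)) :
        v.adicCompletion F → Circle) :=
    isLocallyConstant_mulShift (adeleAddCharAt F v) hlv _
  -- `ψ′ = (ψ_v(t·))(s²·)`
  have e : ψ' = ((adeleAddCharAt F v).mulShift ((unitAt F t v : (v.adicCompletion F)ˣ) : v.adicCompletion F)).mulShift
      ((s : v.adicCompletion F) * s) := by
    refine DFunLike.ext _ _ fun r => ?_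
    rw [hψ', AddChar.mulShift_apply, AddChar.mulShift_apply, mul_assoc]
    rfl
  subst e
  -- step 1: the square-class dilation (over the identity of `Sp(β_T)`, intertwined by `D_s`)
  obtain ⟨e₂, he₂, he₂'⟩ := exists_mpPsi_equiv_mulShift_sq (localPairing F N T v)
    ((adeleAddCharAt F v).mulShift ((unitAt F t v : (v.adicCompletion F)ˣ) : v.adicCompletion F)) hlt hb s hl'
  -- step 2: centre rescaling straight into `LocalMp F N T′ v` (identity intertwiner)
  have hT : ∀ (h : Heisenberg (polar (localPairing F N T v))) (f : SchwartzBruhat (Fin N → v.adicCompletion F)),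
      (LinearEquiv.refl ℂ (SchwartzBruhat (Fin N → v.adicCompletion F)))
          (schrodingerSB (localPairing F N T v)
            ((adeleAddCharAt F v).mulShift ((unitAt F t v : (v.adicCompletion F)ˣ) : v.adicCompletion F)) hlt hb h f) =
        localSchrodinger F N T' v
          (Heisenberg.centerRescale (polar (localPairing F N T v)) (polar (localPairing F N T' v)) (unitAt F t v)
            (polar_localPairing_of_eq_smul F N T T' t hTT' v) h)
          ((LinearEquiv.refl ℂ (SchwartzBruhat (Fin N → v.adicCompletion F))) f) := fun h f => by
    rw [LinearEquiv.refl_apply, LinearEquiv.refl_apply]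
    exact schrodingerSB_mulShift_eq_localSchrodinger_centerRescale F N T T' t hTT' v hlt hb h f
  have hφ := centerRescale_ofSymplectic_act_localSp F N T T' t hTT' v
  refine ⟨e₂.trans (MpPsi.congr _ (localSchrodinger F N T' v) hT hφ), fun p => ?_, fun p f => ?_⟩
  · show (((MpPsi.proj _ ((MpPsi.congr _ (localSchrodinger F N T' v) hT hφ) (e₂ p))) : LocalSp F N T' v) :
        ((Fin N → v.adicCompletion F) × (Fin N → v.adicCompletion F)) ≃ₗ[v.adicCompletion F]
          ((Fin N → v.adicCompletion F) × (Fin N → v.adicCompletion F))) = _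
    rw [MpPsi.proj_congr, MulEquiv.subgroupCongr_apply, he₂]
  · show MpPsi.toRep (localSchrodinger F N T' v) ((MpPsi.congr _ (localSchrodinger F N T' v) hT hφ) (e₂ p)) _ = _
    have h₁ := MpPsi.toRep_congr_apply _ (localSchrodinger F N T' v) hT hφ (e₂ p)
      (leviEquivSB (LinearEquiv.smulOfUnit s) (continuous_const_smul (s : v.adicCompletion F))
        (continuous_const_smul ((s⁻¹ : (v.adicCompletion F)ˣ) : v.adicCompletion F)) f)
    exact h₁.trans (he₂' p f)

include hTT' in
/-- **P4, local form — `κ`-edition**: the same with the unit written as `κ` and the square-class datum as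
`s·s·t = κ` (the shape produced by weak approximation) and `ψ′(r) = ψ_v(κ r)` (the shape produced by the Galois
twist `σ ∘ ψ_v = ψ_v(χ_cyc(σ)·)`). [cite: MoeglinVignerasWaldspurger1987, Chap. 2 II.1 and II Remarques (2)–(3)] -/
theorem exists_mpPsi_equiv_localMp_of_sq_mul_eq
    (ψ' : AddChar (v.adicCompletion F) Circle) (hl' : IsLocallyConstant (⇑ψ' : v.adicCompletion F → Circle))
    (hb : ∀ y : Fin N → v.adicCompletion F, Continuous fun u : Fin N → v.adicCompletion F => localPairing F N T v u y)
    (κ : v.adicCompletion F) (s : (v.adicCompletion F)ˣ)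
    (hκ : (s : v.adicCompletion F) * s * algebraMap F (v.adicCompletion F) (t : F) = κ)
    (hψ' : ∀ r, ψ' r = adeleAddCharAt F v (κ * r)) :
    ∃ e : MpPsi (schrodingerSB (localPairing F N T v) ψ' hl' hb) ≃* LocalMp F N T' v,
      (∀ p, ((MpPsi.proj _ (e p) : LocalSp F N T' v) :
          ((Fin N → v.adicCompletion F) × (Fin N → v.adicCompletion F)) ≃ₗ[v.adicCompletion F]
            ((Fin N → v.adicCompletion F) × (Fin N → v.adicCompletion F))) =
        (MpPsi.proj _ p : LocalSp F N T v)) ∧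
      ∀ p (f : SchwartzBruhat (Fin N → v.adicCompletion F)),
        MpPsi.toRep (localSchrodinger F N T' v) (e p)
            (leviEquivSB (LinearEquiv.smulOfUnit s) (continuous_const_smul (s : v.adicCompletion F))
              (continuous_const_smul ((s⁻¹ : (v.adicCompletion F)ˣ) : v.adicCompletion F)) f) =
          leviEquivSB (LinearEquiv.smulOfUnit s) (continuous_const_smul (s : v.adicCompletion F))
            (continuous_const_smul ((s⁻¹ : (v.adicCompletion F)ˣ) : v.adicCompletion F)) (MpPsi.toRep _ p f) :=
  exists_mpPsi_equiv_localMp_of_mulShift F N T T' t hTT' v ψ' hl' hb s fun r => by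
    rw [hψ', ← hκ, mul_comm ((s : v.adicCompletion F) * s)]

end Chain

/-! ## §4 With the unitary group: `ι^{T′}_δ ∘ scaleInl = ι^T_δ` on `𝕎_v`, and transported sections -/

section Unitary

include hTT' in
/-- **`ι^{T′}_δ(scaleInl k) = ι^T_δ(k)` as automorphisms of `𝕎_v`** (`T′ = t•T`): both are `u ↦ k u` on `(E ⊗ F_v)ᴺ` read in the
SAME coordinates `u = x + δ y` — the Gram matrix enters `ι` only through the TYPE of the target symplectic group.
[cite: MoeglinVignerasWaldspurger1987, Ch. 1 I.17; GelbartRogawski1991, §3.1 p. 454] -/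
theorem coe_iota_scaleInl (k : localPi E c N J v) :
    ((iota F E c N hcδ hδ hd T' hT' hJ' v (scaleInl F E c N T T' t hTT' hJ hJ' v k) : LocalSp F N T' v) :
        ((Fin N → v.adicCompletion F) × (Fin N → v.adicCompletion F)) ≃ₗ[v.adicCompletion F]
          ((Fin N → v.adicCompletion F) × (Fin N → v.adicCompletion F))) =
      (iota F E c N hcδ hδ hd T hT hJ v k : LocalSp F N T v) := by
  refine LinearEquiv.ext fun w => ?_
  rw [iota_def, iota_def]
  change (localToSymplectic E c N v hcδ hδ hd hT' hJ'
      (localPiEquiv E c N _ v (scaleInl F E c N T T' t hTT' hJ hJ' v k))).1 w =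
    (localToSymplectic E c N v hcδ hδ hd hT hJ (localPiEquiv E c N J v k)).1 w
  set x := (QuadraticCoordinates.reIm (quadraticLocalEquiv E v c hcδ hδ).toLinearEquiv.toAddEquiv (Fin N)).symm w with hx
  have hw : w = QuadraticCoordinates.reIm (quadraticLocalEquiv E v c hcδ hδ).toLinearEquiv.toAddEquiv (Fin N) x := by
    rw [hx, AddEquiv.apply_symm_apply]
  rw [hw, localToSymplectic_reIm, localToSymplectic_reIm, coe_localPiEquiv_scaleInl]

set_option maxHeartbeats 400000 in
include hTT' in
/-- **P4 for sections over `ι`.**  A homomorphism `σ : U(J)(F_v) →* S̃p_{ψ′}(𝕎_v, β_T)` over `ι^T_δ`, for `ψ′(r) = ψ_v(t s² r)`,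
yields `σ′ : U(tJ)(F_v) →* LocalMp F N T′ v` over `ι^{T′}_δ` with `ω_{σ′}(scaleInl k) (D_s f) = D_s (ω_σ(k) f)`: the
`ψ′`-oscillator package of `(T, δ)` is the `ψ_v`-oscillator package of `(tT, δ)` up to the explicit intertwiner `D_s`
(hence they have the same isomorphism-class invariants).
[cite: MoeglinVignerasWaldspurger1987, Chap. 2 II.1 (B) and II Remarques (2)–(3); GelbartRogawski1991, §3.1 p. 454] -/
theorem exists_section_localMp_of_mulShift
    (ψ' : AddChar (v.adicCompletion F) Circle) (hl' : IsLocallyConstant (⇑ψ' : v.adicCompletion F → Circle))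
    (hb : ∀ y : Fin N → v.adicCompletion F, Continuous fun u : Fin N → v.adicCompletion F => localPairing F N T v u y)
    (s : (v.adicCompletion F)ˣ)
    (hψ' : ∀ r, ψ' r = adeleAddCharAt F v
      (algebraMap F (v.adicCompletion F) (t : F) * ((s : v.adicCompletion F) * s) * r))
    (σ : localPi E c N J v →* MpPsi (schrodingerSB (localPairing F N T v) ψ' hl' hb))
    (hσ : ∀ k, MpPsi.proj _ (σ k) = iota F E c N hcδ hδ hd T hT hJ v k) :
    ∃ σ' : localPi E c N J' v →* LocalMp F N T' v,
      (∀ k', MpPsi.proj _ (σ' k') = iota F E c N hcδ hδ hd T' hT' hJ' v k') ∧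
      ∀ (k : localPi E c N J v) (f : SchwartzBruhat (Fin N → v.adicCompletion F)),
        MpPsi.toRep (localSchrodinger F N T' v) (σ' (scaleInl F E c N T T' t hTT' hJ hJ' v k))
            (leviEquivSB (LinearEquiv.smulOfUnit s) (continuous_const_smul (s : v.adicCompletion F))
              (continuous_const_smul ((s⁻¹ : (v.adicCompletion F)ˣ) : v.adicCompletion F)) f) =
          leviEquivSB (LinearEquiv.smulOfUnit s) (continuous_const_smul (s : v.adicCompletion F))
            (continuous_const_smul ((s⁻¹ : (v.adicCompletion F)ˣ) : v.adicCompletion F)) (MpPsi.toRep _ (σ k) f) := by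
  obtain ⟨e, he, he'⟩ := exists_mpPsi_equiv_localMp_of_mulShift F N T T' t hTT' v ψ' hl' hb s hψ'
  refine ⟨(e.toMonoidHom.comp σ).comp (scaleInv F E c N T T' t hTT' hJ hJ' v), fun k' => ?_, fun k f => ?_⟩
  · apply Subtype.ext
    have h1 := he (σ (scaleInv F E c N T T' t hTT' hJ hJ' v k'))
    have h2 := coe_iota_scaleInl F E c N hcδ hδ hd T T' hT hT' t hTT' hJ hJ' v (scaleInv F E c N T T' t hTT' hJ hJ' v k')
    rw [scaleInl_scaleInv] at h2
    have h3 := hσ (scaleInv F E c N T T' t hTT' hJ hJ' v k')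
    calc _ = ((MpPsi.proj _ (e (σ (scaleInv F E c N T T' t hTT' hJ hJ' v k'))) : LocalSp F N T' v) :
              ((Fin N → v.adicCompletion F) × (Fin N → v.adicCompletion F)) ≃ₗ[v.adicCompletion F]
                ((Fin N → v.adicCompletion F) × (Fin N → v.adicCompletion F))) := rfl
      _ = _ := by rw [h1, h3, h2]
  · have hk : scaleInv F E c N T T' t hTT' hJ hJ' v (scaleInl F E c N T T' t hTT' hJ hJ' v k) = k :=
      scaleInv_scaleInl F E c N T T' t hTT' hJ hJ' v k
    calc _ = MpPsi.toRep (localSchrodinger F N T' v) (e (σ (scaleInv F E c N T T' t hTT' hJ hJ' v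
              (scaleInl F E c N T T' t hTT' hJ hJ' v k)))) (leviEquivSB (LinearEquiv.smulOfUnit s)
              (continuous_const_smul (s : v.adicCompletion F))
              (continuous_const_smul ((s⁻¹ : (v.adicCompletion F)ˣ) : v.adicCompletion F)) f) := rfl
      _ = _ := by rw [hk]; exact he' (σ k) f

include hTT' in
/-- **P4 for sections over `ι` — `κ`-edition** (`s·s·t = κ`, `ψ′(r) = ψ_v(κ r)`).
[cite: MoeglinVignerasWaldspurger1987, Chap. 2 II.1 (B) and II Remarques (2)–(3); GelbartRogawski1991, §3.1 p. 454] -/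
theorem exists_section_localMp_of_sq_mul_eq
    (ψ' : AddChar (v.adicCompletion F) Circle) (hl' : IsLocallyConstant (⇑ψ' : v.adicCompletion F → Circle))
    (hb : ∀ y : Fin N → v.adicCompletion F, Continuous fun u : Fin N → v.adicCompletion F => localPairing F N T v u y)
    (κ : v.adicCompletion F) (s : (v.adicCompletion F)ˣ)
    (hκ : (s : v.adicCompletion F) * s * algebraMap F (v.adicCompletion F) (t : F) = κ)
    (hψ' : ∀ r, ψ' r = adeleAddCharAt F v (κ * r))
    (σ : localPi E c N J v →* MpPsi (schrodingerSB (localPairing F N T v) ψ' hl' hb))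
    (hσ : ∀ k, MpPsi.proj _ (σ k) = iota F E c N hcδ hδ hd T hT hJ v k) :
    ∃ σ' : localPi E c N J' v →* LocalMp F N T' v,
      (∀ k', MpPsi.proj _ (σ' k') = iota F E c N hcδ hδ hd T' hT' hJ' v k') ∧
      ∀ (k : localPi E c N J v) (f : SchwartzBruhat (Fin N → v.adicCompletion F)),
        MpPsi.toRep (localSchrodinger F N T' v) (σ' (scaleInl F E c N T T' t hTT' hJ hJ' v k))
            (leviEquivSB (LinearEquiv.smulOfUnit s) (continuous_const_smul (s : v.adicCompletion F))
              (continuous_const_smul ((s⁻¹ : (v.adicCompletion F)ˣ) : v.adicCompletion F)) f) =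
          leviEquivSB (LinearEquiv.smulOfUnit s) (continuous_const_smul (s : v.adicCompletion F))
            (continuous_const_smul ((s⁻¹ : (v.adicCompletion F)ˣ) : v.adicCompletion F)) (MpPsi.toRep _ (σ k) f) :=
  exists_section_localMp_of_mulShift F E c N hcδ hδ hd T T' hT hT' t hTT' hJ hJ' v ψ' hl' hb s
    (fun r => by rw [hψ', ← hκ, mul_comm ((s : v.adicCompletion F) * s)]) σ hσ

end Unitary

end Literature.NumberTheory.GelbartRogawski1991.UnitaryDualPair.LocalSplitting

end
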